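import Summits.BirchSwinnertonDyer.BirchSwinnertonDyer.Theorems.SignedLowerHalvesSmallImageLowerHalfBothSignsRttD2SeqJ3CofreePairing
import Summits.BirchSwinnertonDyer.BirchSwinnertonDyer.Theorems.SignedLowerHalvesSmallImageLowerHalfBothSignsRttD2SeqJ3Localization
import HarnessLib

/-!
# Route `SignedLowerHalves`, crux L `SmallImageLowerHalfBothSigns` (stmt-BirchSwinnertonDyer-23599), line `rtt_w3` v14 → v15 — E2, row J3 (Galois side, part β₃d, stage 3):
# THE COEFFICIENT PAIRINGS `Pk : X_k × M[p^k] → μ_{p^k}` OF THE J3 ASSEMBLY FOR THE LEAD's `M = Cofree θ F`, AS `ContPairing`s OVER `Γ_{K_v}`, WITH THE BINDERS `hPred` AND `hPsc`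

WIDTH seat `bsd-line-slh-p3-w3` g22 under LEAD `cruxlead-stmt-BirchSwinnertonDyer-23599` g11 (cell `bsd-ssimc`); helper `--supports stmt-BirchSwinnertonDyer-23599`.
ONE DEFINITION WITH BODY (`cofreeCoeffPairing`) + THEOREMS; no named fact, no instance, no `sorry`. HONEST FRAMING: discharges the input (β₃d) of `exists_junction_exact_of_inputs`
(p790304) / `exists_junction_exact_of_levelwise` (p790532) for the LEAD's module `M = Cofree θ (padicCoeffField S)` (consumer p784278), under the ONE arithmetic hypothesis
`hθ : θ′(σ)·θ(σ)₀₀ = 1` (honda's twist character `θ′` is the inverse of the rank-one character `θ` of `M` — RULING (F1)/(F2) fix `θ′ = θ*`) and the consumer's pin `hres`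
(`Γ_{K_v}` acts on `M` through `res_v`). After this file the J3 inputs that remain are EXACTLY the two levelwise Poitou–Tate statements `R` (reciprocity) and `hsolL` (solvability).
E2, crux L, crux M and BSD remain OPEN and are proved for NO curve.

* ★★ `cofreeCoeffPairing … k : ContPairing (locCoeffRep S θ′ P v k).toTopRep (torsRep M hstab p k).toTopRep (muAt K (p^k) v).toTopRep` (`⟪a ⊗ ζ, t/p^k⟫ = Tr(a t)·ζ`; `ContPairing.ofDiscrete`;
  equivariance from `cofreeTracePairing_muTwistO_smul`, p791577), `cofreeCoeffPairing_toLin`;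
* ★ `cofreeCoeffPairing_hPred`, ★ `cofreeCoeffPairing_hPsc` — the binders `hPred`/`hPsc` of p790304 VERBATIM for `Pk := cofreeCoeffPairing …`.
References: [Rubin2000] §4.2; [NeukirchSchmidtWingberg2008] (7.2.6); [Kato2004Asterisque] §13.8, §17.13.
-/

set_option autoImplicit false
set_option linter.dupNamespace false -- D-0017: single-problem summit, the namespace repeats the problem name by design
noncomputable section

open scoped Classical
open NumberField IsDedekindDomain Field Matrix

namespace Summit.BirchSwinnertonDyer.BirchSwinnertonDyer.Theorems.SmallImageRttD2Seq

open Literature.NumberTheory.EllipticCurves Literature.NumberTheory.EllipticCurves.GreenbergSelmer Literature.NumberTheory.GaloisRepresentations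
  Literature.NumberTheory.GaloisRepresentations.DiscreteGaloisModule Literature.NumberTheory.GaloisCohomology
  Literature.NumberTheory.ComplexMultiplication.EllipticUnits.JohnsonLeungKings2011

section Coeff

variable {K : Type} [Field K] [NumberField K] {p : ℕ} [Fact p.Prime] (S : Set (PadicAlgCl p))
  (θ' : absoluteGaloisGroup K →ₜ* (padicCoeffIntegers S)ˣ) (P : Set (HeightOneSpectrum (𝓞 K))) (v : HeightOneSpectrum (𝓞 K))
  (θ : FramedGaloisRep K (padicCoeffIntegers S) 1)
  [DistribMulAction (absoluteGaloisGroup (v.adicCompletion K)) (Cofree θ (padicCoeffField S))]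
  (hres : ∀ (σ : absoluteGaloisGroup (v.adicCompletion K)) (m : Cofree θ (padicCoeffField S)), σ • m = resGalOfEmb (closureEmb (K := K) (v.adicCompletion K)) σ • m)
  (hstab : ∀ m : Cofree θ (padicCoeffField S),
    IsOpen (MulAction.stabilizer (absoluteGaloisGroup (v.adicCompletion K)) m : Set (absoluteGaloisGroup (v.adicCompletion K))))
  (hθ : ∀ σ : absoluteGaloisGroup K,
    ((θ' σ : (padicCoeffIntegers S)ˣ) : padicCoeffIntegers S) * ((θ σ : GL (Fin 1) (padicCoeffIntegers S)) : Matrix (Fin 1) (Fin 1) (padicCoeffIntegers S)) 0 0 = 1)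

/-- The trace pairing as a `ℤ`-bilinear map `X_k × M[p^k] → μ_{p^k}` on the carriers (`X_k` = the `N_P`-invariants of `𝒪 ⊗ μ_{p^k} ⊗ θ′`). [cite: Rubin2000, §4.2] -/
def cofreeCoeffLin (k : ℕ) :
    ↥(Representation.invariants ((muTwistO S θ' k).toRepresentation.comp (ramificationSubgroup K P).subtype)) →ₗ[ℤ]
      ↥(torsionPow (Cofree θ (padicCoeffField S)) p k) →ₗ[ℤ] MuCarrier K (p ^ k) :=
  LinearMap.mk₂ ℤ (fun x m ↦ cofreeTracePairing S K θ k (x : OMuCarrier K S (p ^ k)) m)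
    (fun x x' m ↦ by
      change cofreeTracePairing S K θ k ((x : OMuCarrier K S (p ^ k)) + x') m = _
      rw [map_add, AddMonoidHom.add_apply])
    (fun c x m ↦ by
      change cofreeTracePairing S K θ k (c • (x : OMuCarrier K S (p ^ k))) m = _
      rw [map_zsmul]; rfl)
    (fun x m m' ↦ map_add _ m m')
    (fun c x m ↦ map_zsmul _ c m)

omit [NumberField K] in
/-- Unfolding `cofreeCoeffLin`. [folklore] -/
theorem cofreeCoeffLin_apply (k : ℕ) (x : ↥(Representation.invariants ((muTwistO S θ' k).toRepresentation.comp (ramificationSubgroup K P).subtype)))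
    (m : ↥(torsionPow (Cofree θ (padicCoeffField S)) p k)) :
    cofreeCoeffLin S θ' P θ k x m = cofreeTracePairing S K θ k (x : OMuCarrier K S (p ^ k)) m :=
  rfl

/-- ★★ **The coefficient pairing `Pk : X_k × M[p^k] → μ_{p^k}` over `Γ_{K_v}`** for the LEAD's `M = Cofree θ F` and honda's coefficients `X_k = (𝒪 ⊗ μ_{p^k} ⊗ θ′)^{N_P}` restricted
to `Γ_{K_v}`: `⟪a ⊗ ζ, t/p^k⟫ = Tr_{𝒪/ℤ_p}(a t)·ζ`, equivariant because `θ′θ = 1` (`hθ`) and `Γ_{K_v}` acts on `M` through `res_v` (`hres`). [cite: Rubin2000, §4.2] [cite: NeukirchSchmidtWingberg2008, (7.2.6)] -/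
def cofreeCoeffPairing (k : ℕ) :
    ContPairing (locCoeffRep S θ' P v k).toTopRep (torsRep (Cofree θ (padicCoeffField S)) hstab p k).toTopRep (muAt K (p ^ k) v).toTopRep :=
  ContPairing.ofDiscrete (X := (locCoeffRep S θ' P v k).toTopRep) (Y := (torsRep (Cofree θ (padicCoeffField S)) hstab p k).toTopRep)
    (Z := (muAt K (p ^ k) v).toTopRep) (cofreeCoeffLin S θ' P θ k) fun g x m ↦ by
    haveI : NeZero (p ^ k) := ⟨pow_ne_zero _ (Fact.out : p.Prime).ne_zero⟩
    have hY : ((torsRep (Cofree θ (padicCoeffField S)) hstab p k).toTopRep.ρ g m :  ↥(torsionPow (Cofree θ (padicCoeffField S)) p k)) =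
        resGalOfEmb (closureEmb (K := K) (v.adicCompletion K)) g • m :=
      Subtype.ext (hres g (m : Cofree θ (padicCoeffField S)))
    rw [hY, cofreeCoeffLin_apply, cofreeCoeffLin_apply]
    exact cofreeTracePairing_muTwistO_smul S K θ k θ' (resGalOfEmb (closureEmb (K := K) (v.adicCompletion K)) g) (hθ _) (x : OMuCarrier K S (p ^ k)) m

/-- Unfolding `cofreeCoeffPairing`. [folklore] -/
theorem cofreeCoeffPairing_toLin (k : ℕ) (x : ↥(Representation.invariants ((muTwistO S θ' k).toRepresentation.comp (ramificationSubgroup K P).subtype)))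
    (m : ↥(torsionPow (Cofree θ (padicCoeffField S)) p k)) :
    (cofreeCoeffPairing S θ' P v θ hres hstab hθ k).toLin x m = cofreeTracePairing S K θ k (x : OMuCarrier K S (p ^ k)) m :=
  rfl

/-- ★ **`hPred` for `Pk := cofreeCoeffPairing`** (the binder of p790304 verbatim): compatibility with reduction on `X` and inclusion on `M[p^k]`, through `μ_{p^k} ⊆ μ_{p^{k+1}}`.
[cite: NeukirchSchmidtWingberg2008, (7.1.4), (7.2.6)] -/
theorem cofreeCoeffPairing_hPred (k : ℕ) (x : ↥(Representation.invariants ((muTwistO S θ' (k + 1)).toRepresentation.comp (ramificationSubgroup K P).subtype)))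
    (m : ↥(torsionPow (Cofree θ (padicCoeffField S)) p k)) :
    (cofreeCoeffPairing S θ' P v θ hres hstab hθ (k + 1)).toLin x (AddSubgroup.inclusion (torsionPow_mono (M := Cofree θ (padicCoeffField S)) (p := p) (Nat.le_succ k)) m) =
      muInclusion K (pow_dvd_pow p (Nat.le_succ k)) ((cofreeCoeffPairing S θ' P v θ hres hstab hθ k).toLin (coeffMapO S P θ' (oMuRed S k) (oMuRed_muTwistO S θ' k) x) m) := by
  rw [cofreeCoeffPairing_toLin, cofreeCoeffPairing_toLin]
  exact (muInclusion_cofreeTracePairing_oMuRed S K θ k (x : OMuCarrier K S (p ^ (k + 1))) m).symm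

/-- ★ **`hPsc` for `Pk := cofreeCoeffPairing`** (the binder of p790304 verbatim): the `𝒪`-balance `⟪(a ⊗ id) x, m⟫ = ⟪x, a·m⟫`. [cite: Rubin2000, §4.2] -/
theorem cofreeCoeffPairing_hPsc (k : ℕ) (a : padicCoeffIntegers S) (x : ↥(Representation.invariants ((muTwistO S θ' k).toRepresentation.comp (ramificationSubgroup K P).subtype)))
    (m : ↥(torsionPow (Cofree θ (padicCoeffField S)) p k)) :
    (cofreeCoeffPairing S θ' P v θ hres hstab hθ k).toLin (coeffMapO S P θ' (oMuScalar S (p ^ k) a) (oMuScalar_muTwistO S θ' k a) x) m =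
      (cofreeCoeffPairing S θ' P v θ hres hstab hθ k).toLin x (a • m) := by
  rw [cofreeCoeffPairing_toLin, cofreeCoeffPairing_toLin]
  exact cofreeTracePairing_oMuScalar S K θ k a (x : OMuCarrier K S (p ^ k)) m

end Coeff

end Summit.BirchSwinnertonDyer.BirchSwinnertonDyer.Theorems.SmallImageRttD2Seq

end
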